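import Summits.CriticalPhenomena.PercolationContinuityZ3.Theorems.PercNearOneGluingNoHeavyLowerTailSahiSlotPatternTwoDim
import Summits.CriticalPhenomena.PercolationContinuityZ3.Theorems.PercNearOneGluingNoHeavyLowerTailSahiSlotPatternTwo
import Summits.CriticalPhenomena.PercolationContinuityZ3.Theorems.SahiGridPatternOrderN

/-!
# The two order-`n` pattern functionals of the tree coincide: `sStarN n d A = patternForm d n (1_A)`, hence
# `PatternPosN n d ↔ SlotPatternPos d n`; transfer: `PatternPosN n d` for `d ≤ 2` (every `n`) and `PatternPosN 2 d` (every `d`)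

Support file (lane `prim-masterthm-p3`, generation 18; `--supports stmt-CriticalPhenomena-4575`).  Pure proofs, no definitions,
no `sorry`, standard axioms.

Two formalisations of "Sahi's `C_n` on `d`-dimensional grids is ONE finite inequality on the small cube `[n]^d`" landed in the
tree on 2026-08-22 within hours of each other:
* `SahiSlot.patternForm d n` / `SahiSlot.SlotPatternPos d n` (this lane, files `…SahiSlotPattern*`): Lieb–Sahi's CYCLE form with
  least-element cycle representatives, symmetrised over `S_n^d`;
* `SahiGridPatternN.sStarN n d` / `SahiGridPatternN.PatternPosN n d` (cell `prim-sahi`, files `SahiGridPatternOrderN*`): the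
  RECURSIVE `n`-copy kernel `SahiCopyKernel.copyKernel n` summed over the permutation patterns of `[n]^d`.
The two kernels are different functions of the incidence matrix (already at `n = 3`, see `SahiGridPatternOrderNThree`), but
their pattern sums agree for EVERY real family `f : Fin n → [n]^d → ℝ`:
  `Σ_{τ ∈ S_n^d} K_n(f_i(col τ c)) = patternForm d n f`            (`sum_copyKernel_col_eq_patternForm`),
in particular `(sStarN n d A : ℝ) = patternForm d n (1_{A_0},…,1_{A_{n−1}})` (`sStarN_cast_eq_patternForm`) and
  **`PatternPosN n d ↔ SlotPatternPos d n`**                           (`patternPosN_iff_slotPatternPos`).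
PROOF.  Both kernels satisfy an `n`-copy identity for EVERY probability weight (`SahiCopyKernel.sahiE_eq_sum_copyKernel`,
`SahiSlot.sahiE_gridW_eq_sum_diagForm`); applied to the product of the UNIFORM weights on sub-boxes `S_0 × ⋯ × S_{d−1} ⊆ [n]^d`
this says that the difference of the two kernels sums to zero over all slot families `r : Fin d → Fin n → Fin n` with values
in `S`, for every `S`; the surjective-extraction lemma `SahiSlot.sum_perm_eq_zero_of_forall_into` (inclusion–exclusion over the
images) then makes the difference vanish over the `d`-tuples of permutations, which is the claim.
TRANSFER (new for the `prim-sahi` predicate, kernel-only): `PatternPosN n d` for all `n` and `d ≤ 2`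
(`patternPosN_of_dim_le_two`, from `SahiSlot.slotPatternPos_of_dim_le_two`, i.e. gen 16's two-chain coefficient theorem) —
this contains the seat census `PatternPosN 4 2` and the announced census `PatternPosN 5 2` as theorems — and `PatternPosN 2 d`
for all `d` (`patternPosN_two`, reflected Kleitman).  Conversely every certified / censused cell of `PatternPosN` is a statement
about `SlotPatternPos`.  Nothing here asserts any open cell. [this work]
-/

namespace Summit.CriticalPhenomena.PercolationContinuityZ3.Theorems

open Finset Function Equiv Equiv.Perm
open Literature.Combinatorics.Sahi2008 Literature.Combinatorics.Sahi2008.CycleForm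
open Literature.Probability.LatticeModels

namespace SahiSlot

section CopyKernel

open SahiCopyKernel (copyKernel valMatrix incMatrix sahiE_eq_sum_copyKernel map_copyKernel)
open SahiGridPatternN (col sStarN PatternPosN)
open scoped Classical

variable {d n : ℕ}

/-- **The two `n`-copy kernels have the same sum over slot families with values in any sub-box**: for `1 ≤ n`, every real family
`f : Fin n → [n]^d → ℝ` and every `S : Fin d → Finset (Fin n)`,
`Σ_{r into S} (K_n(f_i(r_• c)) − D(f ∘ slot_r)) = 0` — both kernel sums are `Π_a |S_a|^n · E_n` under the product of the uniform
weights on the `S_a` (`sahiE_eq_sum_copyKernel`, `sahiE_gridW_eq_sum_diagForm`). [this work] -/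
theorem sum_into_copyKernel_sub_diagForm_eq_zero (hn : 1 ≤ n) (f : Fin n → Q d n → ℝ) (S : Fin d → Finset (Fin n)) :
    ∑ r ∈ univ.filter (fun r : Fin d → Fin n → Fin n => ∀ a j, r a j ∈ S a),
      (copyKernel n (fun i c => f i (fun a => r a c)) - diagForm d n (fun i => f i ∘ slotMap r)) = 0 := by
  -- empty `S a`: no family maps into `S`
  by_cases hne : ∀ a, (S a).Nonempty
  swap
  · simp only [not_forall, Finset.not_nonempty_iff_eq_empty] at hne
    obtain ⟨a, ha⟩ := hne
    refine sum_eq_zero fun r hr => ?_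
    rw [mem_filter] at hr
    have := hr.2 a ⟨0, hn⟩
    rw [ha] at this
    exact absurd this (Finset.notMem_empty _)
  -- the uniform weights on `S a`
  set g : Fin d → Fin n → ℝ := fun a y => if y ∈ S a then ((S a).card : ℝ)⁻¹ else 0 with hg
  have hgsum : ∀ a, ∑ y, g a y = 1 := by
    intro a
    simp only [hg]
    rw [Finset.sum_ite_mem, Finset.univ_inter, sum_const, nsmul_eq_mul, mul_inv_cancel₀]
    exact_mod_cast (hne a).card_pos.ne'
  -- bridge 1: the recursive copy kernel, re-indexed by slot families `r a c = ω c a`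
  have hbridge1 : sahiE (gridW g) n f =
      ∑ r : Fin d → Fin n → Fin n, slotW g r * copyKernel n (fun i c => f i (fun a => r a c)) := by
    rw [sahiE_eq_sum_copyKernel (gridW g) (sum_gridW g hgsum) n f,
      ← (Equiv.piComm fun (_ : Fin d) (_ : Fin n) => Fin n).sum_comp]
    refine Fintype.sum_congr _ _ fun r => ?_
    have hw : (∏ c, gridW g ((Equiv.piComm fun (_ : Fin d) (_ : Fin n) => Fin n) r c)) = slotW g r := by
      unfold gridW slotW
      rw [Finset.prod_comm]
      rfl
    rw [hw]
    rfl
  -- bridge 2: the cycle form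
  have hbridge2 := sahiE_gridW_eq_sum_diagForm g hgsum hn f
  have hkey : ∑ r : Fin d → Fin n → Fin n, slotW g r *
      (copyKernel n (fun i c => f i (fun a => r a c)) - diagForm d n (fun i => f i ∘ slotMap r)) = 0 := by
    simp only [mul_sub, sum_sub_distrib]
    rw [← hbridge1, ← hbridge2, sub_self]
  -- the monomial weight is the constant `Π_a |S_a|^{-n}` on families into `S` and `0` elsewhere
  set c : ℝ := ∏ a : Fin d, (((S a).card : ℝ)⁻¹) ^ n with hc
  have hcpos : 0 < c := prod_pos fun a _ => pow_pos (inv_pos.2 (by exact_mod_cast (hne a).card_pos)) _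
  have hin : ∀ r : Fin d → Fin n → Fin n, (∀ a j, r a j ∈ S a) → slotW g r = c := by
    intro r hr
    unfold slotW
    refine prod_congr rfl fun a _ => ?_
    rw [prod_congr rfl fun j _ => show g a (r a j) = ((S a).card : ℝ)⁻¹ by simp [hg, hr a j], prod_const, card_univ,
      Fintype.card_fin]
  have hout : ∀ r : Fin d → Fin n → Fin n, ¬ (∀ a j, r a j ∈ S a) → slotW g r = 0 := by
    intro r hr
    push Not at hr
    obtain ⟨a, j, hj⟩ := hr
    unfold slotW
    exact prod_eq_zero (mem_univ a) (prod_eq_zero (mem_univ j) (by simp [hg, hj]))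
  have hw : ∀ r : Fin d → Fin n → Fin n, slotW g r = if (∀ a j, r a j ∈ S a) then c else 0 := by
    intro r
    split_ifs with hr
    · exact hin r hr
    · exact hout r hr
  simp_rw [hw, ite_mul, zero_mul] at hkey
  rw [← sum_filter, ← mul_sum] at hkey
  exact (mul_eq_zero.1 hkey).resolve_left hcpos.ne'

/-- **The pattern sums of the two kernels agree** (every real family, `1 ≤ n`):
`Σ_{τ ∈ S_n^d} K_n((i,c) ↦ f_i(col τ c)) = patternForm d n f`. [this work] -/
theorem sum_copyKernel_col_eq_patternForm (hn : 1 ≤ n) (f : Fin n → Q d n → ℝ) :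
    ∑ τ : Fin d → Perm (Fin n), copyKernel n (fun i c => f i (col τ c)) = patternForm d n f := by
  have hext := sum_perm_eq_zero_of_forall_into (d := d)
    (fun r => copyKernel n (fun i c => f i (fun a => r a c)) - diagForm d n (fun i => f i ∘ slotMap r))
    (fun S => sum_into_copyKernel_sub_diagForm_eq_zero hn f S)
  simp only [sum_sub_distrib, sub_eq_zero] at hext
  -- `patternForm = Σ_τ diagForm (f ∘ act τ)` and `slotMap (fun a => ⇑(τ a)) = act τ`, `col τ c = fun a => τ a c`
  exact hext

/-- The `0/1` incidence matrix of `A` at the pattern `τ` is the real family `1_{A_i}` read at `col τ c`. [this work] -/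
theorem cast_incMatrix_col (A : Fin n → Finset (Q d n)) (τ : Fin d → Perm (Fin n)) (i c : Fin n) :
    ((incMatrix A (col τ) i c : ℤ) : ℝ) = setInd (A i) (col τ c) := by
  unfold incMatrix setInd
  split_ifs <;> simp

/-- **`sStarN = patternForm` on indicators**: `(sStarN n d A : ℝ) = patternForm d n (1_{A_0},…,1_{A_{n−1}})` for `1 ≤ n`. [this work] -/
theorem sStarN_cast_eq_patternForm (hn : 1 ≤ n) (A : Fin n → Finset (Q d n)) :
    ((sStarN n d A : ℤ) : ℝ) = patternForm d n (fun i => setInd (A i)) := by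
  unfold sStarN
  rw [Int.cast_sum, ← sum_copyKernel_col_eq_patternForm hn]
  refine sum_congr rfl fun τ _ => ?_
  have h := map_copyKernel (Int.castRingHom ℝ) n (incMatrix A (col τ))
  simp only [eq_intCast] at h
  rw [h]
  congr 1
  funext i c
  exact cast_incMatrix_col A τ i c

/-- **THE TWO ORDER-`n` PATTERN PREDICATES OF THE TREE ARE EQUIVALENT**: `PatternPosN n d ↔ SlotPatternPos d n`. [this work] -/
theorem patternPosN_iff_slotPatternPos : PatternPosN n d ↔ SlotPatternPos d n := by
  rcases Nat.eq_zero_or_pos n with rfl | hn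
  · exact ⟨fun _ => slotPatternPos_zero_right d, fun _ => SahiGridPatternN.patternPosN_zero d⟩
  constructor
  · intro h U hU
    rw [← sStarN_cast_eq_patternForm hn U]
    exact_mod_cast h U hU
  · intro h A hA
    have := h A hA
    rw [← sStarN_cast_eq_patternForm hn A] at this
    exact_mod_cast this

/-- **TRANSFER, `d ≤ 2`, every order**: `PatternPosN n d` for all `n` and `d ≤ 2` — coefficientwise positivity of `Z^n E_n` for product
weights on grids of dimension `≤ 2` (contains the seat census `PatternPosN 4 2` and the announced `PatternPosN 5 2` as theorems).
[this work] -/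
theorem patternPosN_of_dim_le_two (hd : d ≤ 2) (n : ℕ) : PatternPosN n d :=
  patternPosN_iff_slotPatternPos.2 (slotPatternPos_of_dim_le_two hd n)

/-- **TRANSFER, `n = 2`, every dimension**: `PatternPosN 2 d` (reflected Kleitman). [this work] -/
theorem patternPosN_two (d : ℕ) : PatternPosN 2 d :=
  patternPosN_iff_slotPatternPos.2 (slotPatternPos_two d)

/-- Transport in the other direction: every settled or certified cell of `PatternPosN` is a cell of `SlotPatternPos`. [this work] -/
theorem slotPatternPos_of_patternPosN (h : PatternPosN n d) : SlotPatternPos d n := patternPosN_iff_slotPatternPos.1 h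

end CopyKernel

end SahiSlot

end Summit.CriticalPhenomena.PercolationContinuityZ3.Theorems
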